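import Literature.AlgebraicGeometry.Motives.HodgeStructureFourierTransformSL2Action
import Literature.AlgebraicGeometry.Motives.HodgeStructureExteriorAlgebraSelfAdjoint
import Literature.Algebra.Lie.LefschetzModuleSL2RepresentationFunctoriality
import HarnessLib

/-!
# The transpose of Beauville's `SL₂(K)`-action for the Poincaré pairing `(x, y) ↦ τ_ω(x ∧ y)` on `H•(X) = ⋀W`:
# `τ(ρ(a b ; c d) x ∧ y) = τ(x ∧ ρ(d b ; c a) y)`; Pontryagin multiplication by `e^{bω}` is self-adjoint

[topic AlgebraicGeometry/Motives]

Layer `Literature/AlgebraicGeometry/Motives` (namespace `Literature.AlgebraicGeometry.Motives.ExteriorLefschetz`), lane `lit-hodgefound`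
(Track 2 foundations library; prover seat `lit-hodgefound-p34`, generation 38, row g38-#7), the sequel of
`HodgeStructureFourierTransformSL2Action.lean` (row g38-#2: `sl2Action ω g`, Beauville's §4 theorem), of
`HodgeStructureExteriorAlgebraSelfAdjoint.lean` (row g30-#4: for the Poincaré pairing `τ(x ∧ y)` the degree operator `h` is skew-adjoint
and `L_ω = ω ∧ ·` is self-adjoint — André's "`L` […] auto-adjoint") and of `Literature/Algebra/Lie/LefschetzModuleSL2RepresentationFunctoriality.lean`
(row g38-#3 §4: for such a pairing the adjoint of `ρ(a b ; c d)` is `ρ(d b ; c a)`).  THEOREMS ONLY (no `def`, no named fact, no instance,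
no notation; net debt `0`).

## Sources, VERBATIM

* Y. André, *Pour une théorie inconditionnelle des motifs*, Publ. Math. IHÉS 83 (1996) [Andre1996Motifs], §1.1 (p. 11): "`L` […]
  auto-adjoint", "`ᶜΛ` […] auto-adjoint" (for "l'accouplement de dualité de Poincaré"); Prop. 1.2 (p. 11, last clause: the transposition
  for the Poincaré pairing exchanges `L` and `ᶜΛ` up to the involutions).
* A. Beauville, *The action of SL₂ on abelian varieties*, arXiv:0805.1541 [Beauville2010SL2], §4 Theorem (held p0005): "`(1 0 ; a 1)·z =
  d⁻¹ a^g e^{θ/a} ∗ z`", "`(0 −1 ; 1 0)·z = ℱ(z)`", "`(n 0 ; 0 n⁻¹)·z = n^{−g} n^* z`".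
* H. Lange, *Abelian Varieties over the Complex Numbers* (2023) [Lange2023AbelianVarietiesComplex], §2.5.3 Prop. 2.5.13 ("The Pontryagin
  product in homology is dual to the cup product in cohomology").

## What is PROVED (`τ = trace ω g`, `ρ = sl2Action ω g`, `ω` symplectic of genus `g`)

* **`IsSymplectic.isAdjointPair_sl2Action_trace`**, displayed **`IsSymplectic.trace_sl2Action_mul`**: `τ(ρ(γ) x ∧ y) = τ(x ∧ ρ(γ') y)`
  for `γ' = (d b ; c a)` when `γ = (a b ; c d)` — the anti-automorphism of `SL₂` fixing both unipotent subgroups; in particular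
  `IsSymplectic.trace_sl2Action_mul_of_apply_eq` (`ρ(γ)` is `τ`-SELF-ADJOINT whenever `a = d`: the unipotents `e^{aω} ∧ ·`,
  `a^g (· ⋆ e^{ω/a})`, the Weyl element `ℱ`, `−1`), `IsSymplectic.trace_sl2Action_diagonal_mul` (`τ(tʰ x ∧ y) = τ(x ∧ t^{−h} y)`:
  the adjoint of `ρ(diag(t, t⁻¹))` is `ρ(diag(t, t⁻¹))⁻¹`).
* **`IsSymplectic.trace_pontryagin_expSum_mul`: PONTRYAGIN MULTIPLICATION BY `e^{bω} = Σ_{m ≤ g} (bω)^{⋆… }` — precisely by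
  `Σ_{m ≤ g} (bω)^m/m!` — IS SELF-ADJOINT for the Poincaré pairing**: `τ((x ⋆ e^{bω}) ∧ y) = τ(x ∧ (y ⋆ e^{bω}))` (`b ≠ 0`, `g ≥ 1`;
  the lower unipotent `ρ(1 0 ; b⁻¹ 1) = b^{−g} (· ⋆ e^{bω})` is self-adjoint).
* (The special cases `τ(ℱx ∧ y) = τ(x ∧ ℱy)` and `τ(ℱx ∧ ℱy) = (−1)^{k+g} τ(x ∧ y)` are already the tree's
  `IsSymplectic.trace_fourierTransform_mul` (row g37-#3) and `IsSymplectic.trace_fourierTransform_mul_fourierTransform`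
  (`HodgeStructureFourierTransformModularRelations.lean`); not restated.)

## References

* [Andre1996Motifs] Y. André, *Pour une théorie inconditionnelle des motifs*, Publ. Math. IHÉS 83 (1996) 5–49, §1.1, Prop. 1.2 (p. 11).
* [Beauville2010SL2] A. Beauville, *The action of SL₂ on abelian varieties*, J. Ramanujan Math. Soc. 25 (2010) 253–263, arXiv:0805.1541, §4.
* [Lange2023AbelianVarietiesComplex] H. Lange, *Abelian Varieties over the Complex Numbers*, Springer (2023), §2.5.3 Prop. 2.5.13.
-/

noncomputable section

open scoped MatrixGroups Nat

namespace Literature.AlgebraicGeometry.Motives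

namespace ExteriorLefschetz

open Literature.Algebra.Lie ExteriorAlgebra

variable {K : Type*} [Field K] [CharZero K] {W : Type*} [AddCommGroup W] [Module K W] {ω : ExteriorAlgebra K W} {g : ℕ}

/-- **The adjoint of `ρ(a b ; c d)` for the Poincaré pairing `τ(x ∧ y)` is `ρ(d b ; c a)`** (`h` is `τ`-skew, `L_ω` is `τ`-self-adjoint,
hence so are `ᶜΛ` and all the unipotents `ρ(1 a ; 0 1) = exp(a L_ω)`, `ρ(1 0 ; a 1) = exp(a ᶜΛ)`; `(a b ; c d) ↦ (d b ; c a)` is the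
anti-automorphism of `SL₂` fixing them). [cite: Andre1996Motifs, §1.1 (p. 11, "L […] auto-adjoint", "ᶜΛ […] auto-adjoint") and Prop. 1.2 (p. 11)]
[cite: Beauville2010SL2, §4 Theorem] -/
theorem IsSymplectic.isAdjointPair_sl2Action_trace (hω : IsSymplectic ω g) (γ γ' : SL(2, K))
    (hγ' : (γ' : Matrix (Fin 2) (Fin 2) K) = !![(γ : Matrix (Fin 2) (Fin 2) K) 1 1, (γ : Matrix (Fin 2) (Fin 2) K) 0 1;
      (γ : Matrix (Fin 2) (Fin 2) K) 1 0, (γ : Matrix (Fin 2) (Fin 2) K) 0 0]) :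
    ((LinearMap.mul K (ExteriorAlgebra K W)).compr₂ (trace ω g)).IsAdjointPair
      ((LinearMap.mul K (ExteriorAlgebra K W)).compr₂ (trace ω g)) (sl2Action ω g γ) (sl2Action ω g γ') := by
  haveI := hω.finiteDimensional_exteriorAlgebra
  rw [hω.sl2Action_eq]
  exact hω.hasLefschetzProperty_mul.isAdjointPair_sl2Rep_of_coe_eq _ (isSkewAdjoint_shiftedDegree_trace ω g)
    (isSelfAdjoint_mul_trace hω.mem ω g) γ γ' hγ'

/-- Displayed form: **`τ(ρ(a b ; c d) x ∧ y) = τ(x ∧ ρ(d b ; c a) y)`.** [cite: Andre1996Motifs, §1.1 and Prop. 1.2 (p. 11)] [cite: Beauville2010SL2, §4 Theorem] -/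
theorem IsSymplectic.trace_sl2Action_mul (hω : IsSymplectic ω g) (γ γ' : SL(2, K))
    (hγ' : (γ' : Matrix (Fin 2) (Fin 2) K) = !![(γ : Matrix (Fin 2) (Fin 2) K) 1 1, (γ : Matrix (Fin 2) (Fin 2) K) 0 1;
      (γ : Matrix (Fin 2) (Fin 2) K) 1 0, (γ : Matrix (Fin 2) (Fin 2) K) 0 0]) (x y : ExteriorAlgebra K W) :
    trace ω g (sl2Action ω g γ x * y) = trace ω g (x * sl2Action ω g γ' y) := by
  have h1 := hω.isAdjointPair_sl2Action_trace γ γ' hγ' x y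
  simpa only [LinearMap.compr₂_apply, LinearMap.mul_apply'] using h1

/-- **`ρ(γ)` is `τ`-self-adjoint whenever the diagonal entries of `γ` agree** (`(a b ; c a)` is fixed by `(a b ; c d) ↦ (d b ; c a)`):
the unipotents `e^{aω} ∧ ·` and `a^g (· ⋆ e^{ω/a})`, the Weyl element `ρ(0 −1 ; 1 0) = ℱ`, and `ρ(−1)`.
[cite: Andre1996Motifs, §1.1 (p. 11)] [cite: Beauville2010SL2, §4 Theorem] -/
theorem IsSymplectic.trace_sl2Action_mul_of_apply_eq (hω : IsSymplectic ω g) (γ : SL(2, K))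
    (hγ : (γ : Matrix (Fin 2) (Fin 2) K) 0 0 = (γ : Matrix (Fin 2) (Fin 2) K) 1 1) (x y : ExteriorAlgebra K W) :
    trace ω g (sl2Action ω g γ x * y) = trace ω g (x * sl2Action ω g γ y) :=
  hω.trace_sl2Action_mul γ γ (by
    rw [← hγ]
    ext i j
    fin_cases i <;> fin_cases j <;> first | rfl | (simp; exact hγ.symm)) x y

/-- **`τ(tʰ x ∧ y) = τ(x ∧ (tʰ)⁻¹ y)`**: the adjoint of `ρ(diag(t, t⁻¹)) = t^{k−g}` on `⋀ᵏ W` is `ρ(diag(t⁻¹, t)) = ρ(diag(t, t⁻¹))⁻¹`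
(Beauville's `(n 0 ; 0 n⁻¹)·z = n^{−g} n^*z`). [cite: Beauville2010SL2, §4 Theorem] [cite: Andre1996Motifs, §1.1 (p. 11, Poincaré duality pairs H^j with H^{2d−j})] -/
theorem IsSymplectic.trace_sl2Action_diagonal_mul (hω : IsSymplectic ω g) (γ : SL(2, K)) {t : K}
    (hγ : (γ : Matrix (Fin 2) (Fin 2) K) = !![t, 0; 0, t⁻¹]) (x y : ExteriorAlgebra K W) :
    trace ω g (sl2Action ω g γ x * y) = trace ω g (x * sl2Action ω g γ⁻¹ y) :=
  hω.trace_sl2Action_mul γ γ⁻¹ (by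
    rw [Matrix.SpecialLinearGroup.coe_inv, hγ, Matrix.adjugate_fin_two_of]
    ext i j
    fin_cases i <;> fin_cases j <;> simp) x y

/-- **PONTRYAGIN MULTIPLICATION BY `e^{bω} = Σ_{m ≤ g} (bω)^m/m!` IS SELF-ADJOINT FOR THE POINCARÉ PAIRING**:
`τ((x ⋆ e^{bω}) ∧ y) = τ(x ∧ (y ⋆ e^{bω}))` for `b ≠ 0`, `g ≥ 1` — the lower unipotent `ρ(1 0 ; b⁻¹ 1) z = b^{−g} (z ⋆ e^{bω})` is
`τ`-self-adjoint. [cite: Beauville2010SL2, §4 Theorem ("(1 0 ; a 1)·z = d⁻¹ a^g e^{θ/a} ∗ z")] [cite: Lange2023AbelianVarietiesComplex, §2.5.3 Prop. 2.5.13]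
[cite: Andre1996Motifs, §1.1 (p. 11, "ᶜΛ […] auto-adjoint")] -/
theorem IsSymplectic.trace_pontryagin_expSum_mul (hω : IsSymplectic ω g) (hg : 0 < g) {b : K} (hb : b ≠ 0) (x y : ExteriorAlgebra K W) :
    trace ω g (hω.pontryagin x (∑ m ∈ Finset.range (g + 1), (m ! : K)⁻¹ • (b • ω) ^ m) * y) =
      trace ω g (x * hω.pontryagin y (∑ m ∈ Finset.range (g + 1), (m ! : K)⁻¹ • (b • ω) ^ m)) := by
  have hdet : Matrix.det !![(1 : K), 0; b⁻¹, 1] = 1 := by rw [Matrix.det_fin_two_of]; ring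
  have h1 := hω.trace_sl2Action_mul_of_apply_eq (show SL(2, K) from ⟨_, hdet⟩) rfl x y
  rw [hω.sl2Action_apply_of_coe_eq_lower hg _ (inv_ne_zero hb) rfl, hω.sl2Action_apply_of_coe_eq_lower hg _ (inv_ne_zero hb) rfl,
    inv_inv, smul_mul_assoc, mul_smul_comm, map_smul, map_smul] at h1
  exact smul_right_injective K (_root_.pow_ne_zero g (inv_ne_zero hb)) h1

end ExteriorLefschetz

end Literature.AlgebraicGeometry.Motives
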